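import Literature.NumberTheory.ComplexMultiplication.CMTypeUniformization
import Literature.AlgebraicGeometry.HodgeTheory.IsoTransport
import Literature.AlgebraicGeometry.Motives.AbelianVarietyIsogenyProofs
import HarnessLib

/-!
# A uniformisation of type `(K, Φ, 𝔞)` transports along an isomorphism of structures (Shimura 1998, §17.3, §18.4)

Topic `Literature/NumberTheory/ComplexMultiplication`, namespace `Literature.NumberTheory.ComplexMultiplication`.
Cell `hodgecm-mathlib` (D-0151), fan B-II, typer API for row **D1** (`CMTypeUniformization`, Shimura's «`(A, ι)` is of
type `(K, Φ, 𝔞)` with respect to `ξ`», (18.4a)).  PROVED plumbing, no named facts: if `(A, ι)` is of type `(K, Φ, 𝔞)`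
with respect to `ξ : ℂ^Φ/D(𝔞) → A(ℂ)` and `λ : (A, ι) ≅ (A′, ι′)` is an isomorphism of structures over `ℂ`
(`λ ∘ ι(a) = ι′(a) ∘ λ` for `a ∈ 𝔬_K`), then `(A′, ι′)` is of type `(K, Φ, 𝔞)` with respect to `λ ∘ ξ` — Shimura
§17.3 p. 117 («an isomorphism `λ` of `𝒫` to `𝒫′` … `λ ∘ ξ`»), §18.4 p. 126.  The one non-formal input is that the
analytification transports along an isomorphism of `ℂ`-schemes (Serre, GAGA §2; the tree's
`IsAnalytification.transport_iso`), together with `dim A = dim A′` (`AbelianVariety.dim_eq_of_isIsogeny`).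

Consumer (cell bus, A-plan1 `a2-casselman-descent` v2, stub `stub_existsOverNumberField` second conjunct / A-p02
milestone 2): from `CMTypeUniformization.exists_of_type Φ 𝔞` (a complex `(A, ι, ξ)` of type `(K, Φ, 𝔞)`) and
Shimura's Prop. 26 (`shimura1998_prop26_definedOverNumberField`: a model `(A₀, ι₀)` over a number field with
`e : A₀ ⊗ ℂ ≅ A`, `ι₀(a)_ℂ ∘ e = e ∘ ι(a)`), `ξ.ofIso e.symm _` is a uniformisation of
`(A₀ ⊗ ℂ, (A₀.endBaseChange ℂ) ∘ ι₀)` of type `(K, Φ, 𝔞)` (`nonempty_iff_of_iso`).  Stated over `k = ℂ` (the base of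
`IsAnalytification.transport_iso`); the same transport over a subfield `k ⊂ ℂ` is on demand.

## References

* [Shimura1998] G. Shimura, *Abelian Varieties with Complex Multiplication and Modular Functions*, Princeton 1998,
  §17.3 p. 117 (isomorphisms of structures, `λ ∘ ξ`), §18.4 (18.4a) p. 126.
* [SerreGAGA1956] J.-P. Serre, *Géométrie algébrique et géométrie analytique*, §2 (functoriality of `X ↦ X^h`).
* [MumfordAV1970] D. Mumford, *Abelian Varieties*, §4 (homomorphisms act on points by group homomorphisms).
-/

noncomputable section

open scoped Classical nonZeroDivisors
open CategoryTheory NumberField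

universe u

namespace Literature.AlgebraicGeometry.Motives.AbelianVariety

variable {k : Type u} [Field k] {A A' : AbelianVariety k}

/-- The isomorphism of underlying `k`-schemes (objects of `SchemeOver k`) of an isomorphism `e : A ≅ A′` of abelian
varieties (forget the group structure; Mumford §4). [cite: MumfordAV1970, §4 (homomorphisms of abelian varieties)] -/
def isoX (e : A ≅ A') : A.X ≅ A'.X where
  hom := e.hom.hom.hom.hom
  inv := e.inv.hom.hom.hom
  hom_inv_id := congr_arg (fun f : A ⟶ A => f.hom.hom.hom) e.hom_inv_id
  inv_hom_id := congr_arg (fun f : A' ⟶ A' => f.hom.hom.hom) e.inv_hom_id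

/-- Unfolding: `(isoX e).hom` is the underlying `k`-morphism of `e.hom`. [cite: MumfordAV1970, §4] -/
@[simp]
theorem isoX_hom (e : A ≅ A') : (isoX e).hom = e.hom.hom.hom.hom := rfl

/-- Unfolding: `(isoX e).inv` is the underlying `k`-morphism of `e.inv`. [cite: MumfordAV1970, §4] -/
@[simp]
theorem isoX_inv (e : A ≅ A') : (isoX e).inv = e.inv.hom.hom.hom := rfl

/-- Isomorphic abelian varieties have the same dimension (an isomorphism is an isogeny;
`dim_eq_of_isIsogeny`). [cite: MumfordAV1970, §4 and §7 (isogenies preserve dimension)] -/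
theorem dim_eq_of_iso (e : A ≅ A') : A.dim = A'.dim := by
  haveI : IsIso (Hom.toSchemeHom e.hom) :=
    ⟨Hom.toSchemeHom e.inv, by rw [← toSchemeHom_comp, e.hom_inv_id]; rfl,
      by rw [← toSchemeHom_comp, e.inv_hom_id]; rfl⟩
  exact dim_eq_of_isIsogeny (f := e.hom) ⟨inferInstance, inferInstance⟩

end Literature.AlgebraicGeometry.Motives.AbelianVariety

namespace Literature.NumberTheory.ComplexMultiplication

open Literature.AlgebraicGeometry.Motives (CMType AbelianVariety AlgPoints)
open Literature.AlgebraicGeometry.Motives.AbelianVariety (isoX dim_eq_of_iso)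
open Literature.Geometry.Kaehler
open Literature.NumberTheory.Transcendental (IsAnalytification)
open CMTypeLattice

namespace CMTypeUniformization

variable {K : Type} [Field K] [NumberField K] {Φ : CMType K} {𝔞 : (FractionalIdeal (𝓞 K)⁰ K)ˣ}
  {A A' : AbelianVariety ℂ} {ι : 𝓞 K →+* End A} {ι' : 𝓞 K →+* End A'}

/-- **Transport of a uniformisation along an isomorphism of structures** (Shimura §17.3 p. 117: for an isomorphism
`λ : (A, ι) → (A′, ι′)`, `λ ∘ ι(a) = ι′(a) ∘ λ`, the composite `λ ∘ ξ` uniformises `A′`): if `(A, ι)` is of type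
`(K, Φ, 𝔞)` with respect to `ξ` and `e : A ≅ A′` satisfies `ι(a) ≫ e = e ≫ ι′(a)` for all `a ∈ 𝔬_K`, then `(A′, ι′)` is
of type `(K, Φ, 𝔞)` with respect to `e(ℂ) ∘ ξ` — the analytification transports along the isomorphism of
`ℂ`-schemes (`IsAnalytification.transport_iso`, Serre GAGA §2; `dim A = dim A′`), `e(ℂ)` is a group homomorphism on
points (Mathlib `MonObj.mul_comp`), and «`ι′(a) ∘ (e ∘ ξ) = (e ∘ ξ) ∘ Φ(a)`» follows from the hypothesis on `e`.
[cite: Shimura1998, §17.3 p. 117 (isomorphisms of structures «λ ∘ ξ»); §18.4 (18.4a) p. 126] [cite: SerreGAGA1956, §2] -/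
def ofIso (ξ : CMTypeUniformization Φ 𝔞 A ι) (e : A ≅ A') (he : ∀ a : 𝓞 K, ι a ≫ e.hom = e.hom ≫ ι' a) :
    CMTypeUniformization Φ 𝔞 A' ι' where
  toFun := AlgPoints.map e.hom.hom.hom.hom ∘ ξ.toFun
  isAnalytification := by
    have h := ξ.isAnalytification.transport_iso (isoX e)
    rw [dim_eq_of_iso e] at h
    exact h
  toFun_add x y := by
    change AlgPoints.map e.hom.hom.hom.hom (ξ.toFun (x + y)) =
      AlgPoints.map e.hom.hom.hom.hom (ξ.toFun x) * AlgPoints.map e.hom.hom.hom.hom (ξ.toFun y)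
    rw [ξ.toFun_add]
    exact MonObj.mul_comp _ _ e.hom.hom.hom.hom
  toFun_mulMatrix a x := by
    change AlgPoints.map e.hom.hom.hom.hom (ξ.toFun (ComplexTorus.mapMatrix (periodIso Φ 𝔞) (periodIso Φ 𝔞) (mulMatrix 𝔞 a) x)) =
      AlgPoints.map (ι' a).hom.hom.hom (AlgPoints.map e.hom.hom.hom.hom (ξ.toFun x))
    rw [ξ.toFun_mulMatrix, ← AlgPoints.map_comp_apply, ← AlgPoints.map_comp_apply]
    exact congr_arg (fun f : A.X ⟶ A'.X => AlgPoints.map f (ξ.toFun x))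
      (congr_arg (fun f : A ⟶ A' => f.hom.hom.hom) (he a))

/-- Unfolding: `(ξ.ofIso e he)(x) = e(ℂ)(ξ(x))`. [cite: Shimura1998, §17.3 p. 117] -/
@[simp]
theorem ofIso_toFun (ξ : CMTypeUniformization Φ 𝔞 A ι) (e : A ≅ A') (he : ∀ a : 𝓞 K, ι a ≫ e.hom = e.hom ≫ ι' a)
    (x : ComplexTorus (periodIso Φ 𝔞)) :
    (ξ.ofIso e he).toFun x = AlgPoints.map e.hom.hom.hom.hom (ξ.toFun x) := rfl

/-- **`r′ = e ∘ r`**: Shimura's torsion parametrisation `r = ξ ∘ q` of the transported structure is `e(ℂ) ∘ r`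
(«`λ ∘ ξ`» restricted to `q(K/𝔞)`). [cite: Shimura1998, §17.3 p. 117; §18.6 Thm. 18.6 (2) p. 127] -/
@[simp]
theorem ofIso_r (ξ : CMTypeUniformization Φ 𝔞 A ι) (e : A ≅ A') (he : ∀ a : 𝓞 K, ι a ≫ e.hom = e.hom ≫ ι' a)
    (u : K) : (ξ.ofIso e he).r u = AlgPoints.map e.hom.hom.hom.hom (ξ.r u) := rfl

omit [NumberField K] in
/-- The equivariance hypothesis flips along `e.symm`: `ι(a) ≫ e = e ≫ ι′(a)` gives `ι′(a) ≫ e⁻¹ = e⁻¹ ≫ ι(a)`.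
[cite: Shimura1998, §17.3 p. 117 (isomorphisms of structures)] -/
theorem comm_symm_of_comm (e : A ≅ A') (he : ∀ a : 𝓞 K, ι a ≫ e.hom = e.hom ≫ ι' a) (a : 𝓞 K) :
    ι' a ≫ e.symm.hom = e.symm.hom ≫ ι a := by
  rw [Iso.symm_hom, Iso.comp_inv_eq, Category.assoc, Iso.eq_inv_comp]
  exact (he a).symm

/-- **Being of type `(K, Φ, 𝔞)` (with respect to some `ξ`) is invariant under isomorphism of structures**
(`ofIso` along `e` and along `e.symm`). [cite: Shimura1998, §17.3 p. 117; §18.4 (18.4a) p. 126] -/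
theorem nonempty_iff_of_iso (e : A ≅ A') (he : ∀ a : 𝓞 K, ι a ≫ e.hom = e.hom ≫ ι' a) :
    Nonempty (CMTypeUniformization Φ 𝔞 A ι) ↔ Nonempty (CMTypeUniformization Φ 𝔞 A' ι') :=
  ⟨fun ⟨ξ⟩ => ⟨ξ.ofIso e he⟩, fun ⟨ξ'⟩ => ⟨ξ'.ofIso e.symm (comm_symm_of_comm e he)⟩⟩

end CMTypeUniformization

end Literature.NumberTheory.ComplexMultiplication

end
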